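import Summits.BirchSwinnertonDyer.BirchSwinnertonDyer.Theorems.KimAtThreeFineKatoHLogDualUnit
import Summits.BirchSwinnertonDyer.BirchSwinnertonDyer.Theorems.KimAtThreeDeepUpperExpStarFacts
import Summits.BirchSwinnertonDyer.BirchSwinnertonDyer.Theorems.KimAtThreeDeepLowerExpStarOmegaRes
import Summits.BirchSwinnertonDyer.BirchSwinnertonDyer.Theorems.KimAtThreeFineKatoSATPointsRat
import Literature.NumberTheory.PAdicHodge.DualExpEllipticTower
import HarnessLib

/-!
# DUALINT at a factor field from the print fact (S5b-tower) on EVERY additive `t = 0` row (ANY `c₃`):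
# w2-acc4 gen 5's `KimAtThreeFineKatoHLogDualInt` with the Kato-stratum binder `3 ∤ c₃` removed
# (route W2 `KimAtThreeKolyvagin`, item 20398 `FineKatoTwoExpDefectThree`; cell `bsd-addord`, seat w2-acc3 gen 9;
# helper, `--supports 20398`)

HONEST FRAMING.  TOOL theorems only (no definition, no named fact, no `sorry`; the local `Place` instance
attributes are w2-acc4's, byte-identical); the cite fact (S5b-tower) `exists_smul_range_expStarCoord_tower_iff_trace_log`
is a HYPOTHESIS `hS`; closes nothing; nothing booked; BSD is not proved by any of this.

WHAT / WHY.  The chain of record for crux 19560 discharges kim3's part hLog₀ from (S5b-tower) through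
`dualInt_of_towerFact` (w2-acc4 p515410), whose statement carries the stratum binders `Addv W 3`, `3 ∤ c₃`,
`#E(ℚ₃)[3] = 1` and whose proof uses `3 ∤ c₃` in exactly one place — the unit step: both `exp*_d` (by `hdual`) and
`exp*_{e•d}` (by the fact) have range «the `a` with `a · log_ω E(ℚ₃) ⊆ ℤ₃`», which on the stratum is the unit ball
(kim3's `forall_norm_mul_padicLog_le_one_iff_three`), whence `‖ι e‖ = 1`.  For item 20398 (the additive-DEFECT rows,
Kodaira IV/IV* with `c₃ = 3`) that set is `3 ℤ₃` instead — but the unit step only needs the two ranges to be the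
SAME principal lattice `ℤ₃ · G`: §0 `norm_eq_one_of_forall_iff_exists_mul`, with `G = 3^{v₃(c₃)}` from n1011's
`dual_range_padicLog_baseChange_of_addv` (`forall_norm_mul_padicLog_le_one_iff_exists_mul`).  §1 is then w2-acc4's
theorem and proof VERBATIM with `hc` deleted:

* `dualInt_of_towerFact` — for an additive `t = 0` row (`Addv W 3`, `#E(ℚ₃)[3] = 1`, ANY `c₃`), an `hdual`-normalised
  line datum `d` at `ℚ_v`, a line datum `dw` at the factor field `L ⊇ ℚ_v` compatible under restriction ((RES_w),
  cocycle level), and any compatible integral valuation `wL` on `L`: **`‖Tr_{L/ℚ₃}(exp*_{dw}(z) · log_{wL} P′)‖ ≤ 1`**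
  for every class `z ∈ H¹(Γ_L, T₃W)` and every `P′ ∈ E(L)`.
Consumers: this seat's `KimAtThreeFineKatoTwoExpHLogFinal` (hLogᵃ ⟸ (S5b-tower)), feeding `20398 ⟸ cites ∧ hKatoV2ʷ`.
Credit: w2-acc4 gen 5 (statement, proof), kim3 g12 (SAT points), n1011 (range of `log_ω`).

References: S. Bloch, K. Kato (1990) §3 Prop. 3.8, Ex. 3.11 [BlochKato1990]; K. Kato, LNM 1553 (1993) Ch. II
§1.2.4, Thm. 1.4.1 [Kato1993LNM1553]; C.-H. Kim, AJM 148 (2026) §3.2.3, Rem. 3.8, Lemma 3.10 [Kim2022StructureSelmer];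
J.-P. Serre, *Local Fields* (1979) II §5 [SerreLocalFields1979].
-/

noncomputable section

-- the cell's Theorems namespace `Summit.BirchSwinnertonDyer.BirchSwinnertonDyer.…` repeats the summit name by design (D-0017)
set_option linter.dupNamespace false

open scoped TensorProduct NumberField NNReal WithZero Classical
open Field ValuativeRel Function IsDedekindDomain NumberField
open Literature.NumberTheory.GaloisRepresentations
open Literature.NumberTheory.GaloisRepresentations.PeriodRingData
open Literature.NumberTheory.GaloisRepresentations.IsNonarchimedeanLocalField
open Literature.NumberTheory.GaloisCohomology
open Literature.NumberTheory.PAdicHodge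
open Literature.NumberTheory.EllipticCurves WeierstrassCurve
open Literature.NumberTheory.EllipticCurves.FormalGroupChart
open Literature.NumberTheory.EllipticCurves.Rank1Residual
open Summit.BirchSwinnertonDyer.BirchSwinnertonDyer.Theorems.KimAtThreeDeepLowerExpStarOmega
open Summit.BirchSwinnertonDyer.BirchSwinnertonDyer.Theorems.KimAtThreeDeepLowerExpStarOmegaPlace
open Summit.BirchSwinnertonDyer.BirchSwinnertonDyer.Theorems.KimAtThreeDeepLowerExpStarOmegaRes
open Summit.BirchSwinnertonDyer.BirchSwinnertonDyer.Theorems.KimAtThreeDeepUpperExpStarTransport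
open Summit.BirchSwinnertonDyer.BirchSwinnertonDyer.Theorems.KimAtThreeDeepUpperExpStarFacts
open Summit.BirchSwinnertonDyer.BirchSwinnertonDyer.Theorems.KimAtThreeFineKatoSATPointsRat
open Summit.BirchSwinnertonDyer.Rank1Residual.GaloisImage
open Summit.BirchSwinnertonDyer.Rank1Residual.Additive (LocalLog.padicLog)
open Summit.BirchSwinnertonDyer.Rank1Residual.Additive.LocalLog
open Rat.HeightOneSpectrum

namespace Summit.BirchSwinnertonDyer.BirchSwinnertonDyer.Theorems.KimAtThreeFineKatoTwoExpHLog

/-! ### §0. Two scalar lemmas: the unit step for a general principal range-lattice, and the points side at `ℚ₃`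
for ANY `c₃` -/

/-- **The simultaneous rescaling is a unit (general principal lattice).**  If `f, g : H → ℚ_p` satisfy
`g y = c⁻¹ · f y`, `c ≠ 0`, and BOTH have range exactly `ℤ_p · G` for one `G ≠ 0`, then `‖c‖ = 1`
(w2-acc4's `norm_eq_one_of_forall_iff_norm_le_one` is the case `G = 1`). [folklore] -/
theorem norm_eq_one_of_forall_iff_exists_mul {p : ℕ} [Fact p.Prime] {H : Type*} (f g : H → ℚ_[p])
    (c G : ℚ_[p]) (hG : G ≠ 0) (hc0 : c ≠ 0)
    (hf : ∀ a : ℚ_[p], (∃ y, f y = a) ↔ ∃ k : ℤ_[p], (k : ℚ_[p]) * G = a)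
    (hg : ∀ a : ℚ_[p], (∃ y, g y = a) ↔ ∃ k : ℤ_[p], (k : ℚ_[p]) * G = a)
    (hrel : ∀ y, g y = c⁻¹ * f y) : ‖c‖ = 1 := by
  -- `‖c‖ ≤ 1`: `G = g y₁`, so `f y₁ = c·G ∈ ℤ_p·G`
  obtain ⟨y₁, hy₁⟩ := (hg G).mpr ⟨1, by rw [PadicInt.coe_one, one_mul]⟩
  have hfy₁ : f y₁ = c * G := by
    have h := hrel y₁
    rw [hy₁] at h
    rw [h, ← mul_assoc, mul_inv_cancel₀ hc0, one_mul]
  obtain ⟨k, hk⟩ := (hf (c * G)).mp ⟨y₁, hfy₁⟩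
  have hkc : (k : ℚ_[p]) = c := mul_right_cancel₀ hG hk
  have hle : ‖c‖ ≤ 1 := by rw [← hkc]; exact PadicInt.norm_le_one k
  -- `‖c⁻¹‖ ≤ 1`: `G = f y₂`, so `g y₂ = c⁻¹·G ∈ ℤ_p·G`
  obtain ⟨y₂, hy₂⟩ := (hf G).mpr ⟨1, by rw [PadicInt.coe_one, one_mul]⟩
  obtain ⟨k', hk'⟩ := (hg (c⁻¹ * G)).mp ⟨y₂, by rw [hrel, hy₂]⟩
  have hkc' : (k' : ℚ_[p]) = c⁻¹ := mul_right_cancel₀ hG hk'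
  have hle' : ‖c⁻¹‖ ≤ 1 := by rw [← hkc']; exact PadicInt.norm_le_one k'
  rw [norm_inv] at hle'
  have hpos : 0 < ‖c‖ := norm_pos_iff.mpr hc0
  have h1 : 1 ≤ ‖c‖ := by
    rcases inv_le_one_iff₀.mp hle' with h | h
    · exact absurd h (not_le.mpr hpos)
    · exact h
  exact le_antisymm hle h1

/-- `t = 0` in n1011's currency: `#E(ℚ₃)[3] = 1` gives `v₃ #E(ℚ₃)_tors = 0` (Cauchy). [folklore] -/
private theorem padicValNat_card_torsion_eq_zero (W : WeierstrassCurve ℚ) [W.IsElliptic] [W.IsGloballyMinimal]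
    (ht : Nat.card {Q : (W.baseChange ℚ_[3]).toAffine.Point // (3 : ℕ) • Q = 0} = 1) :
    padicValNat 3 (Nat.card (AddCommGroup.torsion (W.baseChange ℚ_[3]).toAffine.Point)) = 0 := by
  have ht' := KimAtThreeFineKatoSATPoints.forall_p_nsmul_eq_zero_of_natCard_eq_one (W.baseChange ℚ_[3]) ht
  apply padicValNat.eq_zero_of_not_dvd
  intro hdvd
  haveI := finite_torsion_point (W.baseChange ℚ_[3])
  obtain ⟨T, hT⟩ := exists_prime_addOrderOf_dvd_card'
    (G := AddCommGroup.torsion (W.baseChange ℚ_[3]).toAffine.Point) 3 hdvd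
  have hpT' : 3 • T = 0 := by
    have h := addOrderOf_nsmul_eq_zero T
    rwa [hT] at h
  have hpT : (3 : ℕ) • (T : (W.baseChange ℚ_[3]).toAffine.Point) = 0 := by
    have h := congrArg Subtype.val hpT'
    simpa only [AddSubgroupClass.coe_nsmul, ZeroMemClass.coe_zero] using h
  have hT0 : T = 0 := Subtype.ext (ht' _ hpT)
  rw [hT0, addOrderOf_zero] at hT
  exact absurd hT (by norm_num)

/-- **The points side at `ℚ₃` for ANY `c₃`** (`Addv W 3`, `#E(ℚ₃)[3] = 1`): `a · log_ω(E(ℚ₃)) ⊆ ℤ₃` iff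
`a ∈ ℤ₃ · 3^{v₃(c₃)}` — n1011's `dual_range_padicLog_baseChange_of_addv` (`log_ω E(ℚ₃) = 3^{t − v₃ c₃}ℤ₃`, Kodaira
IV/IV* built in) at `t = 0`. [cite: Kim2022StructureSelmer, §3.2.3 (display before Thm. 3.7) and Lemma 3.10 (PDF pp. 16–17)] -/
theorem forall_norm_mul_padicLog_le_one_iff_exists_mul (W : WeierstrassCurve ℚ) [W.IsElliptic]
    [W.IsGloballyMinimal] (hadd : Addv W 3)
    (ht : Nat.card {Q : (W.baseChange ℚ_[3]).toAffine.Point // (3 : ℕ) • Q = 0} = 1) (a : ℚ_[3]) :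
    (∀ Q : (W.baseChange ℚ_[3]).toAffine.Point, ‖a * LocalLog.padicLog (W.baseChange ℚ_[3]) Q‖ ≤ 1) ↔
      ∃ k : ℤ_[3], (k : ℚ_[3]) * ((3 : ℕ) : ℚ_[3]) ^
        padicValNat 3 ((W.baseChange ℚ_[3]).localTamagawaNumber ℤ_[3]) = a := by
  have key := dual_range_padicLog_baseChange_of_addv W 3 hadd a
  rw [padicValNat_card_torsion_eq_zero W ht, Nat.cast_zero, sub_zero, zpow_natCast,
    Submodule.mem_toAddSubgroup, Submodule.mem_span_singleton] at key
  constructor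
  · intro h
    obtain ⟨k, hk⟩ := key.mp fun y ⟨Q, hQ⟩ => hQ ▸ h Q
    exact ⟨k, by rw [← hk, Algebra.smul_def, PadicInt.algebraMap_apply]⟩
  · rintro ⟨k, rfl⟩ Q
    have hmem := key.mpr ⟨k, by rw [Algebra.smul_def, PadicInt.algebraMap_apply]⟩
    exact hmem _ ⟨Q, rfl⟩


attribute [local instance 100000] NumberField.Place.instAlgebraCompletion
attribute [local instance] valuativeRelPlace topologicalSpacePlace
attribute [local instance] isNonarchimedeanLocalField_place charZero_place
attribute [local instance] padicAlgebraPlace fact_not_isUnit_place isAdicComplete_place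

/-- The place of `ℚ` over `3`. -/
private abbrev v₀ : HeightOneSpectrum (𝓞 ℚ) := (primesEquiv (R := 𝓞 ℚ)).symm ⟨3, Nat.prime_three⟩

/-- `3 ∈ v₀` (the `Fact` the local `Place` instances are indexed by). -/
private theorem fact_three_mem : Fact (((3 : ℕ) : 𝓞 ℚ) ∈ (v₀).asIdeal) :=
  ⟨(Literature.NumberTheory.EllipticCurves.natCast_mem_asIdeal_iff_eq_primesEquiv_symm _ Nat.prime_three).mpr rfl⟩

attribute [local instance] fact_three_mem

variable {L : Type} [Field L] [ValuativeRel L] [TopologicalSpace L] [IsNonarchimedeanLocalField L]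
  [CharZero L] [Algebra (Place.Completion (Sum.inr v₀ : Place ℚ)) L]
  [IsScalarTower ℚ (Place.Completion (Sum.inr v₀ : Place ℚ)) L]
  [Fact (¬ IsUnit ((3 : ℕ) : integerC L))] [IsAdicComplete (Ideal.span {((3 : ℕ) : integerC L)}) (integerC L)]
  (hL : valuation L (3 : ℕ) < 1) [Algebra ℚ_[3] L]

/-- **DUALINT at a factor field from (S5b-tower), on EVERY additive `t = 0` row (ANY `c₃`)** — w2-acc4 gen 5's
`KimAtThreeFineKatoHLog.dualInt_of_towerFact` with the Kato-stratum binder `3 ∤ c₃` REMOVED.  The only use of that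
binder in the original was the unit step `‖ι e‖ = 1` («both `exp*_d` and `exp*_{e•d}` have range the unit ball»);
here both have range `3^{v₃(c₃)} ℤ₃` (the dual of `log_ω E(ℚ₃) = 3^{−v₃(c₃)} ℤ₃`, n1011's
`dual_range_padicLog_baseChange_of_addv` at `t = 0`), and two maps with the SAME principal range-lattice that differ
by the constant `(ι e)⁻¹` force `‖ι e‖ = 1` (`norm_eq_one_of_forall_iff_exists_mul`).  Everything else — (S5b-tower)
at `(ℚ_v, L)`, the `e₃` round trips, the rigidity of `ℚ₃ → L`, `forall_norm_apply_mul_le_one_of_range` — is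
w2-acc4's proof unchanged.  See the module docstring.
[cite: BlochKato1990, §3 Prop. 3.8 and Example 3.11] [cite: Kato1993LNM1553, Ch. II §1.2.4 and Thm. 1.4.1]
[cite: Kim2022StructureSelmer, §3.2.3 (display before Thm. 3.7) and Lemma 3.10 (PDF pp. 16–17)] -/
theorem dualInt_of_towerFact (hS : exists_smul_range_expStarCoord_tower_iff_trace_log)
    (W : WeierstrassCurve ℚ) [W.IsElliptic] [W.IsGloballyMinimal]
    (hadd : Addv W 3)
    (ht : Nat.card {Q : (W.baseChange ℚ_[3]).toAffine.Point // (3 : ℕ) • Q = 0} = 1)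
    (d : LocalNeronLineAt W 3 v₀)
    (hinj : (bdRPeriodRingData (valuation_place_lt_one 3 v₀)).CupLogInjective (logCyclotomic 3)
      (localRationalTateRep W 3 (galRestrictPlace v₀)))
    (hex : ∀ z : contOneCocycles (localRationalTateRep W 3 (galRestrictPlace v₀)).toTopRep,
      (bdRPeriodRingData (valuation_place_lt_one 3 v₀)).HasDualExp (logCyclotomic 3)
        (localRationalTateRep W 3 (galRestrictPlace v₀)) fun σ => z.1 σ)
    (hdual : ∀ a : ℚ_[3], (∃ y, expStarOmegaPadicAt d hinj hex
        (((Padic.adicCompletionEquiv (𝓞 ℚ) ⟨3, Nat.prime_three⟩).symm :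
          (v₀).adicCompletion ℚ →+* ℚ_[3])) y = a) ↔
      ∀ Q : (W.baseChange ℚ_[3]).toAffine.Point, ‖a * padicLog (W.baseChange ℚ_[3]) Q‖ ≤ 1)
    (dw : (bdRPeriodRingData hL).FilZeroLine
      ((restrictedRationalTateRep W (Place.Completion (Sum.inr v₀ : Place ℚ)) 3).restrict
        (absGaloisRestrict (Place.Completion (Sum.inr v₀ : Place ℚ)) L)))
    (hinjw : (bdRPeriodRingData hL).CupLogInjective (logCyclotomic 3)
      ((restrictedRationalTateRep W (Place.Completion (Sum.inr v₀ : Place ℚ)) 3).restrict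
        (absGaloisRestrict (Place.Completion (Sum.inr v₀ : Place ℚ)) L)))
    (hexw : ∀ z : contOneCocycles ((restrictedRationalTateRep W (Place.Completion (Sum.inr v₀ : Place ℚ)) 3).restrict
        (absGaloisRestrict (Place.Completion (Sum.inr v₀ : Place ℚ)) L)).toTopRep,
      (bdRPeriodRingData hL).HasDualExp (logCyclotomic 3)
        ((restrictedRationalTateRep W (Place.Completion (Sum.inr v₀ : Place ℚ)) 3).restrict
          (absGaloisRestrict (Place.Completion (Sum.inr v₀ : Place ℚ)) L)) fun σ => z.1 σ)
    (hresw : ∀ (η₀ : contOneCocycles (restrictedTateRep W (Place.Completion (Sum.inr v₀ : Place ℚ)) 3).toTopRep)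
        (η : contOneCocycles ((restrictedTateRep W (Place.Completion (Sum.inr v₀ : Place ℚ)) 3).restrict
          (absGaloisRestrict (Place.Completion (Sum.inr v₀ : Place ℚ)) L)).toTopRep),
        (∀ σ, η.1 σ = η₀.1 (absGaloisRestrict (Place.Completion (Sum.inr v₀ : Place ℚ)) L σ)) →
        expStarCoordTower W hL dw η =
          algebraMap (Place.Completion (Sum.inr v₀ : Place ℚ)) L
            (expStarCoord W (valuation_place_lt_one 3 v₀) d η₀))
    (wL : Valuation L ℝ≥0) [wL.Compatible] [(W.baseChange L).IsIntegral wL.integer]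
    (η : contOneCocycles ((restrictedTateRep W (Place.Completion (Sum.inr v₀ : Place ℚ)) 3).restrict
      (absGaloisRestrict (Place.Completion (Sum.inr v₀ : Place ℚ)) L)).toTopRep)
    (P' : (W.baseChange L).toAffine.Point) :
    ‖Algebra.trace ℚ_[3] L
        (expStarCoordTower W hL dw η * padicLogPointFiniteExt wL (W.baseChange L) 3 P')‖ ≤ 1 := by
  -- (0) `ℚ_v ≃ ℚ₃` (Mathlib's `Padic.adicCompletionEquiv`, inverse) and the transported `3`-adic norm
  let e₃ : ℚ_[3] ≃A[ℚ] (v₀).adicCompletion ℚ := Padic.adicCompletionEquiv (𝓞 ℚ) ⟨3, Nat.prime_three⟩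
  let eA0 : (v₀).adicCompletion ℚ ≃ₐ[ℚ] ℚ_[3] := e₃.symm.toAlgEquiv
  let eA : Place.Completion (Sum.inr v₀ : Place ℚ) ≃ₐ[ℚ] ℚ_[3] := eA0
  have heA : ∀ x, eA0 x = e₃.symm x := fun _ => rfl
  have hcont : Continuous eA0.symm := by
    have : ∀ y, eA0.symm y = e₃ y := fun y => by
      apply eA0.injective
      rw [AlgEquiv.apply_symm_apply, heA]
      exact (e₃.symm_apply_apply y).symm
    exact (continuous_congr this).mpr e₃.continuous
  have hball : ∀ x : (v₀).adicCompletion ℚ, ‖eA0 x‖ ≤ 1 ↔ x ∈ (v₀).adicCompletionIntegers ℚ := by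
    intro x
    constructor
    · intro h
      have hx : x = e₃ ((⟨eA0 x, h⟩ : ℤ_[3]) : ℚ_[3]) := by
        change x = e₃ (e₃.symm x)
        exact (e₃.apply_symm_apply x).symm
      rw [hx, ← PadicInt.coe_adicCompletionIntegersEquiv_apply]
      exact SetLike.coe_mem _
    · intro h
      have hx : eA0 x = ((PadicInt.adicCompletionIntegersEquiv (𝓞 ℚ) ⟨3, Nat.prime_three⟩).symm ⟨x, h⟩ : ℚ_[3]) := by
        rw [PadicInt.coe_adicCompletionIntegersEquiv_symm_apply]
        rfl
      rw [hx]
      exact PadicInt.norm_le_one _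
  let w' : Valuation ((v₀).adicCompletion ℚ) ℝ≥0 :=
    (NormedField.valuation (K := ℚ_[3])).comap (eA0 : (v₀).adicCompletion ℚ →+* ℚ_[3])
  let w : Valuation (Place.Completion (Sum.inr v₀ : Place ℚ)) ℝ≥0 := w'
  have hw : ∀ x, w' x = ‖eA0 x‖₊ := fun x => rfl
  haveI : w.Compatible := compatible_of_norm_algEquiv _ v₀ eA0 w' hw hball
  haveI hIv : (W.baseChange ((v₀).adicCompletion ℚ)).IsIntegral w'.integer :=
    isIntegral_baseChange_of_norm_algEquiv eA0 hw W
  haveI : (W.baseChange (Place.Completion (Sum.inr v₀ : Place ℚ))).IsIntegral w.integer := hIv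
  -- (2) the fact at `(ℚ_v, L)`
  obtain ⟨e, he, hA, hB⟩ := hS W (valuation_place_lt_one 3 v₀) w hL wL d dw hinj hex hinjw hexw hresw
  -- (3) the unit step at `ℚ_v`
  set ι : (v₀).adicCompletion ℚ →+* ℚ_[3] :=
    ((Padic.adicCompletionEquiv (𝓞 ℚ) ⟨3, Nat.prime_three⟩).symm : (v₀).adicCompletion ℚ →+* ℚ_[3]) with hιdef
  have hι : ∀ x, ι x = eA x := fun x => rfl
  -- the common range lattice `3^{v₃(c₃)} ℤ₃` of `exp*_d` and `exp*_{e•d}` (ANY `c₃`)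
  have hS3 : ∀ a : ℚ_[3], (∀ Q : (W.baseChange ℚ_[3]).toAffine.Point,
      ‖a * LocalLog.padicLog (W.baseChange ℚ_[3]) Q‖ ≤ 1) ↔
      ∃ k : ℤ_[3], (k : ℚ_[3]) * ((3 : ℕ) : ℚ_[3]) ^ padicValNat 3 ((W.baseChange ℚ_[3]).localTamagawaNumber ℤ_[3]) = a :=
    fun a => forall_norm_mul_padicLog_le_one_iff_exists_mul W hadd ht a
  have hf : ∀ a : ℚ_[3], (∃ y, expStarOmegaPadicAt d hinj hex ι y = a) ↔
      ∃ k : ℤ_[3], (k : ℚ_[3]) * ((3 : ℕ) : ℚ_[3]) ^ padicValNat 3 ((W.baseChange ℚ_[3]).localTamagawaNumber ℤ_[3]) = a :=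
    fun a => (hdual a).trans (hS3 a)
  have hg : ∀ a : ℚ_[3], (∃ y, expStarOmegaPadicAt (d.smul e he) hinj hex ι y = a) ↔
      ∃ k : ℤ_[3], (k : ℚ_[3]) * ((3 : ℕ) : ℚ_[3]) ^ padicValNat 3 ((W.baseChange ℚ_[3]).localTamagawaNumber ℤ_[3]) = a := by
    intro a
    rw [← hS3 a]
    have key := hA (eA.symm a)
    -- LEFT: classes vs crossed homomorphisms, `ℚ₃` vs `ℚ_v` values
    have hLft : (∃ y, expStarOmegaPadicAt (d.smul e he) hinj hex ι y = a) ↔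
        ∃ η : contOneCocycles (restrictedTateRep W (Place.Completion (Sum.inr v₀ : Place ℚ)) 3).toTopRep,
          expStarCoord W (valuation_place_lt_one 3 v₀) (d.smul e he) η = eA.symm a := by
      constructor
      · rintro ⟨y, hy⟩
        obtain ⟨η, rfl⟩ := oneCocycleClass_surjective _ y
        refine ⟨η, ?_⟩
        rw [expStarOmegaPadicAt_apply, expStarOmegaAt_eq_expStarCoord] at hy
        rw [← hy]
        exact (eA.symm_apply_apply _).symm
      · rintro ⟨η, hη⟩
        refine ⟨oneCocycleClass _ η, ?_⟩
        rw [expStarOmegaPadicAt_apply, expStarOmegaAt_eq_expStarCoord, hη]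
        exact eA.apply_symm_apply a
    -- RIGHT: trace = `eA`, points and logarithms transported along `eA`
    haveI := isIntegral_valuationInteger_of_isIntegral_padicInt (W.baseChange ℚ_[3])
    have hlog : ∀ P : (W.baseChange (Place.Completion (Sum.inr v₀ : Place ℚ))).toAffine.Point,
        eA (eA.symm a * padicLogPointFiniteExt w (W.baseChange (Place.Completion (Sum.inr v₀ : Place ℚ))) 3 P) =
          a * LocalLog.padicLog (W.baseChange ℚ_[3])
            (WeierstrassCurve.Affine.Point.map (eA : Place.Completion (Sum.inr v₀ : Place ℚ) →ₐ[ℚ] ℚ_[3]) P) := by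
      intro P
      rw [map_mul, AlgEquiv.apply_symm_apply, padicLog_eq_padicLogPointFiniteExt]
      congr 1
      exact (padicLogPointFiniteExt_map_algEquiv eA0 hw W P).symm
    have htr : ∀ x : Place.Completion (Sum.inr v₀ : Place ℚ),
        Algebra.trace ℚ_[3] (Place.Completion (Sum.inr v₀ : Place ℚ)) x = eA x :=
      fun x => trace_eq _ v₀ eA0 Fact.out hcont x
    have hRgt : (∀ P : (W.baseChange (Place.Completion (Sum.inr v₀ : Place ℚ))).toAffine.Point,
        ‖Algebra.trace ℚ_[3] (Place.Completion (Sum.inr v₀ : Place ℚ))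
            (eA.symm a * padicLogPointFiniteExt w (W.baseChange (Place.Completion (Sum.inr v₀ : Place ℚ))) 3 P)‖ ≤ 1) ↔
        ∀ Q : (W.baseChange ℚ_[3]).toAffine.Point, ‖a * LocalLog.padicLog (W.baseChange ℚ_[3]) Q‖ ≤ 1 := by
      constructor
      · intro h Q
        obtain ⟨P, rfl⟩ := exists_map_algEquiv_eq eA0 W Q
        have hP := h P
        rwa [htr, hlog] at hP
      · intro h P
        rw [htr, hlog]
        exact h _
    exact hLft.trans (key.trans hRgt)
  have hrel : ∀ y, expStarOmegaPadicAt (d.smul e he) hinj hex ι y = (ι e)⁻¹ * expStarOmegaPadicAt d hinj hex ι y := by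
    intro y
    have hsm : expStarOmegaAt (d.smul e he) y = e⁻¹ * expStarOmegaAt d y :=
      expStarOmega_smul (valuation_place_lt_one 3 v₀) (galRestrictPlace v₀) d he y
    rw [expStarOmegaPadicAt_apply, expStarOmegaPadicAt_apply, hsm, map_mul, map_inv₀]
    rfl
  have hιe : ι e ≠ 0 := (map_ne_zero ι).mpr he
  have hunit : ‖ι e‖ = 1 := norm_eq_one_of_forall_iff_exists_mul _ _ (ι e) _
    (pow_ne_zero _ (Nat.cast_ne_zero.mpr (by norm_num))) hιe hf hg hrel
  -- (4) integrality at `L`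
  have he' : algebraMap (Place.Completion (Sum.inr v₀ : Place ℚ)) L e ≠ 0 := (map_ne_zero _).mpr he
  have hsmul : ∀ η', expStarCoordTower W hL (dw.smul (algebraMap (Place.Completion (Sum.inr v₀ : Place ℚ)) L e) he') η' =
      (algebraMap (Place.Completion (Sum.inr v₀ : Place ℚ)) L e)⁻¹ * expStarCoordTower W hL dw η' :=
    fun η' => dw.dualExpCoord_smul he' _
  -- `e` acts on `L` through `ℚ₃ → L` (rigidity of ring maps `ℚ₃ → ℚ_v`, `ℚ₃ → L`)
  have hT : ∀ x : L, Algebra.trace ℚ_[3] L (algebraMap (Place.Completion (Sum.inr v₀ : Place ℚ)) L e * x) =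
      ι e * Algebra.trace ℚ_[3] L x := by
    intro x
    have h2 : algebraMap ℚ_[3] (Place.Completion (Sum.inr v₀ : Place ℚ)) (ι e) = e :=
      (algebraMap_eq_symm 3 v₀ eA0 Fact.out hcont (eA0 e)).trans (eA0.symm_apply_apply e)
    have h3 : (algebraMap (Place.Completion (Sum.inr v₀ : Place ℚ)) L).comp
        (algebraMap ℚ_[3] (Place.Completion (Sum.inr v₀ : Place ℚ))) = algebraMap ℚ_[3] L :=
      LocalField.ringHom_padic_ext _ _
    have h1 : algebraMap (Place.Completion (Sum.inr v₀ : Place ℚ)) L e = algebraMap ℚ_[3] L (ι e) := by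
      rw [← h3, RingHom.comp_apply, h2]
    rw [h1, ← Algebra.smul_def, LinearMap.map_smul, smul_eq_mul]
  refine KimAtThreeFineKatoHLog.forall_norm_apply_mul_le_one_of_range (fun η' => expStarCoordTower W hL dw η')
    (fun η' => expStarCoordTower W hL (dw.smul (algebraMap (Place.Completion (Sum.inr v₀ : Place ℚ)) L e) he') η')
    (Algebra.trace ℚ_[3] L) (Set.range fun P : (W.baseChange L).toAffine.Point =>
      padicLogPointFiniteExt wL (W.baseChange L) 3 P)
    _ (ι e) he' hunit.le hT (fun a => (hB a).trans ?_) hsmul η ⟨P', rfl⟩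
  rw [Set.forall_mem_range]

end Summit.BirchSwinnertonDyer.BirchSwinnertonDyer.Theorems.KimAtThreeFineKatoTwoExpHLog

end
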